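import Literature.NumberTheory.LFunctions.Zhang2022.Section14Eq143Core
import Literature.NumberTheory.LFunctions.Zhang2022.RepairGapProp21ScaleLaw
import HarnessLib

/-!
# Zhang (2022), rescue GAP/REQSIDE (D-0124 (4)–(5)): the SCALE LAW of the (14.3) core — the twin of the
# (7.5) chain at the length `2P₄`: rate `𝔓𝓛^{−k}` from Proposition 2.1 at exponent `717 + 4k`, i.e. from
# (A) at exponent `2000 + 4k` (`k ≤ 5`); the typed rate `𝓛⁻⁵` costs `2020`, the weakest rate `𝓛⁻¹` costs `2004`

Topic `Literature/NumberTheory/LFunctions/Zhang2022` (Landau–Siegel audit tree; verdict-neutral).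
Y. Zhang, *Discrete mean estimates and the Landau–Siegel zero*, arXiv:2211.02515v1 (2022)
[Zhang2022LandauSiegel] — **an unrefereed manuscript under adjudication; nothing in this file asserts or
denies its Theorems 1–2, and nothing here is a claim about Landau–Siegel zeros. The programme SEARCHES and
TYPES; no claim about Landau–Siegel zeros, Theorems 1–2 of arXiv:2211.02515 or a repaired Margin232 until a
kernel theorem says so.**

(14.3) (§14 p. 76: "in a way similar to the proof of (7.5), by Proposition 2.1 and the large sieve inequality
… the sum over `ψ ∈ Ψ₁` can be extended to `Ψ`") is carried by the tree's `Typed.Sec14.Eq143.core`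
(`Section14Eq143Core`: `X⁴ ≤ U²V·#Ψ₂ ≤ (c_U P²𝓛²²⁵)²(c_V P²𝓛³⁶)(C₂₁𝔓𝓛⁻⁷³⁹)`, `P² ≤ 2𝔓𝓛⁷⁷`, hence
`X⁴ ≤ c𝔓⁴𝓛^{717−739} = c𝔓⁴𝓛⁻²²` and the TYPED rate `K𝔓𝓛⁻⁵` via `𝓛⁻²² ≤ 𝓛⁻²⁰`). The count `2(225+77) + (36+77)
= 717` is the same as (7.5)'s (the located budget's `e_req`, `Repair.Gap.ExpTuple.eReq`). This file re-runs the
core with Proposition 2.1's exponent free and the rate as a parameter: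

* `core143_scale_of_prop21_rate` — GIVEN Lemma 3.3 (ii) (`Skeleton.Lemma33b`, a theorem of the tree) and ANY
  eventual count `#Ψ₂ ≤ C𝔓𝓛^{−(717+4k)}` under a guard `AssumptionAWith E`: for every `B` there is `K` with, for all
  large `D` under that guard, all `κ*, a*` subject to (14.1)–(14.2) and `Re s = ½`,
  `Σ_{ψ∈Ψ₂}|Σ_{m≤P²}κ*(m)ψ(m)m^{−s}|·|Σ_{n≤2P₄}a*(n)ψ̄(n)n^{s−1}| ≤ K·𝔓·𝓛^{−k}` (the tree proof verbatim with
  `739 ↦ 717 + 4k`, `22 ↦ 4k`, `5 ↦ k`);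
* `core143_scale_of_assumptionAWith` — hence under `Repair.Bed.AssumptionAWith E` for every real
  `E ≥ 2000 + 4k`, `k ≤ 5` (over `prop21_scale_of_assumptionAWith (717 + 4k)`; Lemma 3.4 caps `717 + 4k ≤ 740`).

READING (GAP G-31 / REQSIDE (5), as-typed): the (14.3) core at rate `𝓛^{−k}` costs (A) at `2000 + 4k`: the typed
node's `𝓛⁻⁵` costs `2020`, the weakest polynomial rate `𝓛⁻¹` costs `2004` (an `ε𝔓`-form, as for (7.5), would
cost `2001`; not typed here). Sufficiency only; theorems only; no definition, no named fact; nothing about (A).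

## References

* Y. Zhang, arXiv:2211.02515v1 (2022), §14 (14.3) p. 76; §7 (7.5) p. 35; §2 Prop. 2.1; §3 Lemma 3.3.
  [cite: Zhang2022LandauSiegel, §14 (14.3) p. 76; §7 (7.5) p. 35]
-/

noncomputable section

open Finset Complex Real ComplexConjugate

namespace Literature.NumberTheory.LFunctions.Zhang2022.Repair.Gap

open Literature.NumberTheory.LFunctions.Zhang2022 (frakP)
open Literature.NumberTheory.LFunctions.Zhang2022.Skeleton
open MeanSquareMajorant
open Literature.NumberTheory.LFunctions.Zhang2022.Section7Eq75 (exists_nat_le_ell)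
open Literature.NumberTheory.LFunctions.Zhang2022.Typed.Sec14 (Eq141 Eq142)
open Literature.NumberTheory.LFunctions.Zhang2022.Typed.Sec14.Eq143 (card_finsetOf bigP_sq_le pow_four_le
  floor_two_P4_sq_le sum_sq_kappaPoly_le sum_pow_four_aPoly_le)
open Literature.NumberTheory.LFunctions.Zhang2022.Repair.Bed (AssumptionAWith)

/-- **The (14.3) core with Proposition 2.1's exponent free and the rate as a parameter.** GIVEN Lemma 3.3 (ii)
and an eventual count `#Ψ₂ ≤ C·𝔓·(𝓛^{717+4k})⁻¹` under the guard `AssumptionAWith E`, for every `B` there is `K`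
such that for all large `D`, every real primitive `χ (mod D)` with `AssumptionAWith E D χ`, all `κ*, a*` subject
to (14.1)–(14.2) with constant `B`, and every `s` with `Re s = ½`:
`Σ_{ψ∈Ψ₂} |Σ_{m≤P²} κ*(m)ψ(m)m^{−s}|·|Σ_{n≤2P₄} a*(n)ψ̄(n)n^{s−1}| ≤ K·𝔓·𝓛^{−k}`. The tree's
`Typed.Sec14.Eq143.core` verbatim with `739 ↦ 717 + 4k` (`X⁴ ≤ c𝔓⁴𝓛^{−4k}`, `c ≤ (1+c)⁴`).
[cite: Zhang2022LandauSiegel, §14 (14.3) p. 76; §7 (7.5) p. 35] -/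
theorem core143_scale_of_prop21_rate (h33b : Lemma33b) (B : ℝ) (k : ℕ) {E : ℝ}
    (h21 : ∃ C : ℝ, ForAllLarge fun D _ χ => AssumptionAWith E D χ →
      ((PsiTwo χ).ncard : ℝ) ≤ C * frakP D * (ell D ^ (717 + 4 * k))⁻¹) :
    ∃ K : ℝ, ForAllLarge fun D _ χ => AssumptionAWith E D χ → ∀ κs as : ℕ → ℂ,
      Eq141 B κs → Eq142 D B as → ∀ s : ℂ, s.re = 1 / 2 →
        ∑ x ∈ finsetOf (PsiTwo χ),
          ‖∑ m ∈ Icc 1 ⌊bigP D ^ 2⌋₊, κs m * x.ψ (m : ZMod x.p) * (m : ℂ) ^ (-s)‖ *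
            ‖∑ n ∈ Icc 1 ⌊2 * P4 D⌋₊, as n * conj (x.ψ (n : ZMod x.p)) * (n : ℂ) ^ (s - 1)‖ ≤
          K * frakP D * (ell D ^ k)⁻¹ := by
  obtain ⟨C₂₁, D₁, hD₁⟩ := h21
  obtain ⟨C₃₃, h33⟩ := h33b
  set cU : ℝ := max C₃₃ 0 * (B ^ 2 * (majorantConst 25 10 * 2 ^ 25)) with hcU
  set cV : ℝ := max C₃₃ 0 * (max B 0 ^ 4 * (majorantConst 4 4 * 2 ^ 4)) with hcV
  set c : ℝ := 8 * cU ^ 2 * cV * max C₂₁ 0 with hc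
  have hM25 := majorantConst_pos 25 10; have hM4 := majorantConst_pos 4 4
  have hcU0 : 0 ≤ cU := by positivity
  have hcV0 : 0 ≤ cV := by positivity
  have hc0 : 0 ≤ c := by positivity
  refine ⟨1 + c, ?_⟩
  obtain ⟨D₂, hD₂⟩ := bigP_sq_le
  obtain ⟨D₃, hD₃⟩ := floor_two_P4_sq_le
  obtain ⟨D₄, hD₄⟩ := exists_nat_le_ell 1
  refine ⟨max (max D₁ D₂) (max D₃ D₄), fun D _ χ hD hq hp hA κs as hκ ha s hs => ?_⟩
  simp only [max_le_iff] at hD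
  obtain ⟨⟨hD₁', hD₂'⟩, hD₃', hD₄'⟩ := hD
  have hℓ : 1 ≤ ell D := hD₄ D hD₄'; have hℓ0 : 0 < ell D := by linarith
  haveI : Fintype (Chr D) := Fintype.ofFinite _
  set ℓ : ℝ := ell D with hℓdef; set Pf : ℝ := frakP D with hPf
  have hℓne : ℓ ≠ 0 := hℓ0.ne'
  have hPf0 : 0 ≤ Pf := by
    rw [hPf, frakP_eq_sum_primeWindow]; exact sum_nonneg fun p _ => Nat.cast_nonneg p
  have hU := sum_sq_kappaPoly_le hℓ (h33 D) hκ hs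
  have hV := sum_pow_four_aPoly_le hℓ (hD₃ D hD₃') (h33 D) ha.1 hs
  have hS : ((finsetOf (PsiTwo χ)).card : ℝ) ≤ max C₂₁ 0 * Pf * (ℓ ^ (717 + 4 * k))⁻¹ := by
    rw [card_finsetOf (Set.toFinite _)]
    refine (hD₁ D χ hD₁' hq hp hA).trans ?_
    exact mul_le_mul_of_nonneg_right (mul_le_mul_of_nonneg_right (le_max_left _ _) hPf0)
      (inv_nonneg.mpr (pow_nonneg hℓ0.le _))
  have hP2 : bigP D ^ 2 ≤ 2 * Pf * ℓ ^ 77 := hD₂ D hD₂'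
  have hP20 : 0 ≤ bigP D ^ 2 := sq_nonneg _
  have hU' : ∑ x : Chr D, ‖∑ m ∈ Icc 1 ⌊bigP D ^ 2⌋₊, κs m * x.ψ (m : ZMod x.p) * (m : ℂ) ^ (-s)‖ ^ 2
      ≤ cU * bigP D ^ 2 * ℓ ^ 225 := by
    refine hU.trans (le_of_eq ?_); rw [hcU]; ring
  have hV' : ∑ x : Chr D, ‖∑ n ∈ Icc 1 ⌊2 * P4 D⌋₊,
      as n * conj (x.ψ (n : ZMod x.p)) * (n : ℂ) ^ (s - 1)‖ ^ 4 ≤ cV * bigP D ^ 2 * ℓ ^ 36 := by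
    refine hV.trans (le_of_eq ?_); rw [hcV]; ring
  have hX4 := pow_four_le (finsetOf (PsiTwo χ)) Finset.univ (Finset.subset_univ _)
    (fun x : Chr D => ‖∑ m ∈ Icc 1 ⌊bigP D ^ 2⌋₊, κs m * x.ψ (m : ZMod x.p) * (m : ℂ) ^ (-s)‖)
    (fun x : Chr D => ‖∑ n ∈ Icc 1 ⌊2 * P4 D⌋₊,
      as n * conj (x.ψ (n : ZMod x.p)) * (n : ℂ) ^ (s - 1)‖)
    (fun _ => norm_nonneg _) (fun _ => norm_nonneg _)
  have hUn : 0 ≤ ∑ x : Chr D,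
      ‖∑ m ∈ Icc 1 ⌊bigP D ^ 2⌋₊, κs m * x.ψ (m : ZMod x.p) * (m : ℂ) ^ (-s)‖ ^ 2 :=
    sum_nonneg fun x _ => sq_nonneg _
  have hVn : 0 ≤ ∑ x : Chr D, ‖∑ n ∈ Icc 1 ⌊2 * P4 D⌋₊,
      as n * conj (x.ψ (n : ZMod x.p)) * (n : ℂ) ^ (s - 1)‖ ^ 4 :=
    sum_nonneg fun x _ => by positivity
  have h1 := hX4.trans (mul_le_mul (pow_le_pow_left₀ hUn hU' 2) (mul_le_mul hV' hS (Nat.cast_nonneg _)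
    (hVn.trans hV')) (mul_nonneg hVn (Nat.cast_nonneg _)) (sq_nonneg _))
  have h2 : (cU * bigP D ^ 2 * ℓ ^ 225) ^ 2 *
      ((cV * bigP D ^ 2 * ℓ ^ 36) * (max C₂₁ 0 * Pf * (ℓ ^ (717 + 4 * k))⁻¹)) ≤
      (cU * (2 * Pf * ℓ ^ 77) * ℓ ^ 225) ^ 2 *
        ((cV * (2 * Pf * ℓ ^ 77) * ℓ ^ 36) * (max C₂₁ 0 * Pf * (ℓ ^ (717 + 4 * k))⁻¹)) := by
    have : 0 ≤ (ℓ ^ (717 + 4 * k))⁻¹ := inv_nonneg.mpr (pow_nonneg hℓ0.le _)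
    gcongr
  have h3 : (cU * (2 * Pf * ℓ ^ 77) * ℓ ^ 225) ^ 2 *
      ((cV * (2 * Pf * ℓ ^ 77) * ℓ ^ 36) * (max C₂₁ 0 * Pf * (ℓ ^ (717 + 4 * k))⁻¹)) =
      c * Pf ^ 4 * (ℓ ^ (4 * k))⁻¹ := by
    have h717 : ℓ ^ (717 + 4 * k) = (ℓ ^ 77) ^ 2 * (ℓ ^ 225) ^ 2 * ℓ ^ 77 * ℓ ^ 36 * ℓ ^ (4 * k) := by
      rw [← pow_mul, ← pow_mul, ← pow_add, ← pow_add, ← pow_add, ← pow_add]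
    rw [hc, h717]; field_simp; ring
  have h4 : c * Pf ^ 4 * (ℓ ^ (4 * k))⁻¹ ≤ ((1 + c) * Pf * (ℓ ^ k)⁻¹) ^ 4 := by
    have hK : c ≤ (1 + c) ^ 4 :=
      (le_add_of_nonneg_left zero_le_one).trans (le_self_pow₀ (by linarith) (by norm_num))
    calc c * Pf ^ 4 * (ℓ ^ (4 * k))⁻¹ ≤ (1 + c) ^ 4 * Pf ^ 4 * (ℓ ^ (4 * k))⁻¹ := by
          gcongr
      _ = ((1 + c) * Pf * (ℓ ^ k)⁻¹) ^ 4 := by rw [mul_pow, mul_pow, inv_pow, ← pow_mul, mul_comm k 4]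
  have hK0 : 0 ≤ (1 + c) * Pf * (ℓ ^ k)⁻¹ := by positivity
  exact le_of_pow_le_pow_left₀ (by norm_num) hK0 (h1.trans (h2.trans (h3.le.trans h4)))

/-- **The (14.3) core under (A) at exponent `E ≥ 2000 + 4k` (`k ≤ 5`)**: rate `K·𝔓·𝓛^{−k}` for the
Ψ₂-sum of (14.3), for all large `D`, under `AssumptionAWith E`, all `κ*, a*` subject to (14.1)–(14.2) and
`Re s = ½` — `core143_scale_of_prop21_rate` over `Skeleton.lemma33b_holds` and the Part-I law
`prop21_scale_of_assumptionAWith (717 + 4k)` (Lemma 3.4 caps `717 + 4k ≤ 740`). The typed node's rate `𝓛⁻⁵` is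
`k = 5`: `E ≥ 2020`; the printed (A) gives the tree's `Typed.Sec14.Eq143.core` (not restated).
[cite: Zhang2022LandauSiegel, §14 (14.3) p. 76; §2 Prop. 2.1] -/
theorem core143_scale_of_assumptionAWith (B : ℝ) (k : ℕ) (hk : k ≤ 5) {E : ℝ}
    (hE : ((2000 + 4 * k : ℕ) : ℝ) ≤ E) :
    ∃ K : ℝ, ForAllLarge fun D _ χ => AssumptionAWith E D χ → ∀ κs as : ℕ → ℂ,
      Eq141 B κs → Eq142 D B as → ∀ s : ℂ, s.re = 1 / 2 →
        ∑ x ∈ finsetOf (PsiTwo χ),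
          ‖∑ m ∈ Icc 1 ⌊bigP D ^ 2⌋₊, κs m * x.ψ (m : ZMod x.p) * (m : ℂ) ^ (-s)‖ *
            ‖∑ n ∈ Icc 1 ⌊2 * P4 D⌋₊, as n * conj (x.ψ (n : ZMod x.p)) * (n : ℂ) ^ (s - 1)‖ ≤
          K * frakP D * (ell D ^ k)⁻¹ :=
  core143_scale_of_prop21_rate lemma33b_holds B k
    (prop21_scale_of_assumptionAWith (717 + 4 * k) (by omega) (by push_cast at hE ⊢; linarith))

end Literature.NumberTheory.LFunctions.Zhang2022.Repair.Gap

end
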